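/-
Copyright (c) 2026 the pub-hodgecm-mathlib formalisation cell (harness21).  Prover seat hodgecm-mathlib-K2E4-p11 (g5), Track B ∕ K2-LIT, h413 =
`stmt-HodgeConjecture-24833`, line `K2_E1_TraceFormulaBeta`, campaign «EIS-RANK-ONE» ∕ R8-LADDER-2, «MS-2» — THE OPERATOR ROAD, PART (O2b) continued (dealer K2E1-plan (g6)
ruling (66)): the transport operator `M : L²(Z_T, μZ) →L[ℂ] L²(𝔛, μ)` along a Siegel section, RANK-GENERIC on ★ S-α's binder `hSieg`.
-/
import Summits.HodgeConjecture.HodgeConjecture.Theorems.K2E1BLSiegelSectionU                  -- ★ (this seat) (O2b): the Siegel section, the fibre count `tsum_indicator_fibre_eq`; brings ★ S-α and the unfolding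
import HarnessLib

/-!
# h413 ∕ Track B «K2-LIT», «MS-2» — `K2E1BLSiegelTransportOperatorU` (RANK `N` on the Siegel binder `hSieg`): THE TRANSPORT OPERATOR
# `M : 𝓗_0(Z_T) = L²(Z_T, μZ) →L[ℂ] L²(𝔛, μ)`, `M f = 𝟙_{T < w₁}·(f ∘ σ)`, `‖M f‖ = C^{1/2}·‖f‖`, `(M f) ∘ p = f` a.e. on `Z_T`

Cell `pub/hodgecm-mathlib`, crux H413 = `stmt-HodgeConjecture-24833`, route `HCCMUnconditional`; dealer K2E1-plan (g6) ruling (66) (operator road (O), part (O2)).  THEOREMS ONLY;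
lane `--kind proof --supports stmt-HodgeConjecture-24833 --as helper` (count-neutral; closes no socket).
THE MATHEMATICS [BernsteinLapid2019, §4 Claim 4 p. 10; MoeglinWaldspurger1995, I.2.1].  With a Siegel section `σ : 𝔛 → Z` (★ companion `exists_siegelSection`: measurable, `σ[g⁻¹] = B(F)·g`
for `H(g) > T ≥ 1`) the fibre count ★ `tsum_indicator_fibre_eq` turns the unfolding ★ `exists_forall_mul_lintegral_comp_pZX_eq` (at `k = 0`) into `C·∫_{Z_T} Φ∘p dμZ = ∫_𝔛 Φ dμ` for
`Φ ≥ 0` supported in `𝔛_T = {T < w₁}` (§4a).  Hence `f ↦ 𝟙_{T<w₁}·(f∘σ)` satisfies `∫_𝔛 |𝟙(f∘σ)|² dμ = C·∫_{Z_T}|f∘σ∘p|² dμZ = C·∫_{Z_T}|f|² dμZ` (`σ∘p = id` on `Z_T`): up to `C^{1/2}`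
an ISOMETRY `M : L²(Z_T, μZ) →L[ℂ] L²(𝔛, μ)`, linear because a.e.-identities on `Z_T` pull back through `σ` (§4b, ★ S-α DOWN), with `(M f)(p z) = f z` a.e. on `Z_T` (★ S-α UP).
With ★ (O2a) `exists_highCuspOperator` this yields the high-cusp operator `K_T := M ∘L K_Z : 𝓗_k(𝔛) →L[ℂ] L²(𝔛, μ)` of ★ `exists_family_of_operator_letters` ((O2c)).
* §4a `exists_mul_lintegral_comp_pZX_eq_of_support`;  §4b `ae_congr_comp_section`;  §4 **`exists_siegelTransport`**;  §5 `ae_comp_section_of_ae`.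
HONEST LABEL.  Count-neutral helper; proves no printed statement; HC_CM is proved only modulo the 7 printed citations (2 remaining named inputs: hLiu418 = `stmt-HodgeConjecture-24832`,
h413 = `stmt-HodgeConjecture-24833`) until rung 0 closes.

## References
* [BernsteinLapid2019] J. Bernstein, E. Lapid, *On the meromorphic continuation of Eisenstein series*, J. AMS 37 (2024), §4 Claim 4 (p. 10).
* [MoeglinWaldspurger1995] C. Mœglin, J.-L. Waldspurger, *Spectral decomposition and Eisenstein series* (1995), I.2.1.
* [Garrett2018] P. Garrett, *Modern analysis of automorphic forms by example* (2018), §2.3.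
-/

set_option autoImplicit false
set_option linter.dupNamespace false  -- the mandated namespace repeats the summit's segment (`HodgeConjecture.HodgeConjecture`)

noncomputable section

open MeasureTheory Measure NumberField IsDedekindDomain Set Filter Topology
open scoped ENNReal NNReal
open Literature.MeasureTheory.Group Literature.NumberTheory.Automorphic Literature.NumberTheory.Automorphic.UnitaryGroup AdelicGroupData
open Summit.HodgeConjecture.HodgeConjecture.Cruxes.H413.K2E1BLBorelSpacesU2Defs
open Summit.HodgeConjecture.HodgeConjecture.Cruxes.H413.K2E1BLIotaUnfoldingU (exists_forall_mul_lintegral_comp_pZX_eq measurable_pZX measurable_borelQuotHeight)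
open Summit.HodgeConjecture.HodgeConjecture.Cruxes.H413.K2E1BLHeckeOperatorHXU2 (supHeight_pos measurable_supHeight)
open Summit.HodgeConjecture.HodgeConjecture.Cruxes.H413.K2E1TruncatedCuspCompactU2 (ae_lt_borelQuotHeight_weightedTruncMeasure)
open Summit.HodgeConjecture.HodgeConjecture.Cruxes.H413.K2E1BLSiegelTransportU (supHeight_pZX_eq_of_one_lt ae_comp_pZX_of_ae measure_inter_eq_zero_of_measure_preimage_pZX_eq_zero)
open Summit.HodgeConjecture.HodgeConjecture.Cruxes.H413.K2E1BLSiegelSectionU (tsum_indicator_fibre_eq)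

namespace Summit.HodgeConjecture.HodgeConjecture.Cruxes.H413.K2E1BLSiegelTransportOperatorU

variable {F E : Type} [Field F] [NumberField F] [Field E] [NumberField E] [Algebra F E] {c : E ≃ₐ[F] E} {N : ℕ} [NeZero N]
variable [MeasurableSpace (quasiSplit F E c N).Adelic] [BorelSpace (quasiSplit F E c N).Adelic]

/-! ## §4 The transport operator `M : L²(Z_T, μZ) →L[ℂ] L²(𝔛, μ)` -/

section Transport

variable (μ : Measure (quasiSplit F E c N).automorphicQuotient) [(quasiSplit F E c N).IsAutomorphicMeasure μ]
  (νG : Measure (quasiSplit F E c N).Adelic) [νG.IsHaarMeasure] [νG.IsInvInvariant]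
  {β : (quasiSplit F E c N).Adelic → ℝ≥0∞} (hβ : IsCoveringWeight ↥((arithmeticBorel F E c N).map (quasiSplit F E c N).arithmeticSubgroup.subtype) β)
  {μZ : Measure (borelQuotient F E c N)}
  (hμZ : ∀ f : borelQuotient F E c N → ℝ≥0∞, Measurable f → ∫⁻ z, f z ∂μZ = ∫⁻ g, β g * f (toBorelQuotient F E c N g) ∂νG)

include hβ hμZ in
/-- **THE UNFOLDING ABOVE THE CUT-OFF**: on `hSieg`, `T ≥ 1`, for Borel `Φ ≥ 0` on `𝔛` supported in `𝔛_T = {T < w₁}`: `C·∫⁻_Z Φ∘p d(μZ|_{Z_T}) = ∫⁻_𝔛 Φ dμ` (★ unfolding at `k = 0` and the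
fibre count §3 `= 𝟙_{T<w₁}`). [cite: MoeglinWaldspurger1995, I.2.1] [cite: BernsteinLapid2019, §4 Claim 4 (p. 10)] -/
theorem exists_mul_lintegral_comp_pZX_eq_of_support
    (hSieg : ∀ γ : (quasiSplit F E c N).arithmeticSubgroup, γ ∉ arithmeticBorel F E c N → ∀ g : (quasiSplit F E c N).Adelic,
      1 < borelHeight g → borelHeight ((γ : (quasiSplit F E c N).Adelic) * g) < 1)
    {T : ℝ≥0} (hT : 1 ≤ T) :
    ∃ C : ℝ≥0∞, C ≠ 0 ∧ C ≠ ⊤ ∧ ∀ Φ : (quasiSplit F E c N).automorphicQuotient → ℝ≥0∞, Measurable Φ → (∀ x, ¬ T < supHeight F E c N x → Φ x = 0) →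
      C * ∫⁻ z, Φ (pZX F E c N z) ∂(weightedTruncMeasure F E c N 0 T μZ) = ∫⁻ x, Φ x ∂μ := by
  obtain ⟨C, hC0, hCt, hunf⟩ := exists_forall_mul_lintegral_comp_pZX_eq μ νG hβ hμZ
  refine ⟨C, hC0, hCt, fun Φ hΦ hsupp => ?_⟩
  rw [hunf 0 T Φ hΦ]
  refine lintegral_congr fun x => ?_
  rw [tsum_indicator_fibre_eq hSieg hT 0 x]
  by_cases hx : T < supHeight F E c N x
  · rw [Set.indicator_of_mem (show x ∈ {x | T < supHeight F E c N x} from hx), mul_zero, pow_zero, ENNReal.coe_one, mul_one]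
  · rw [hsupp x hx, zero_mul]

include hβ hμZ in
/-- **An a.e. identity on `Z_T` pulls back through a Siegel section to an a.e. identity on `𝔛_T`** (`σ ∘ p = id` a.e. on `Z_T`; ★ S-α DOWN applied to `S := {T < w₁} ∩ σ⁻¹(bad)`, whose
`p`-preimage lies in `bad` up to a null set). [cite: BernsteinLapid2019, §4 Claim 4 (p. 10)] -/
theorem ae_congr_comp_section {T : ℝ≥0} {σ : (quasiSplit F E c N).automorphicQuotient → borelQuotient F E c N} (hσm : Measurable σ)
    (hσp : ∀ᵐ z ∂(weightedTruncMeasure F E c N 0 T μZ), σ (pZX F E c N z) = z ∧ T < supHeight F E c N (pZX F E c N z))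
    {f₁ f₂ : borelQuotient F E c N → ℂ} (h12 : f₁ =ᵐ[weightedTruncMeasure F E c N 0 T μZ] f₂) :
    ∀ᵐ x ∂μ, T < supHeight F E c N x → f₁ (σ x) = f₂ (σ x) := by
  obtain ⟨Nz, hNsub, hNm, hN0⟩ := exists_measurable_superset_of_null (ae_iff.1 h12)
  set S : Set (quasiSplit F E c N).automorphicQuotient := {x | T < supHeight F E c N x} ∩ σ ⁻¹' Nz with hS
  have hSm : MeasurableSet S := (measurableSet_lt measurable_const measurable_supHeight).inter (hσm hNm)
  have hpre : weightedTruncMeasure F E c N 0 T μZ (pZX F E c N ⁻¹' S) = 0 := by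
    refine measure_mono_null_ae ?_ hN0
    filter_upwards [hσp] with z hz hzS
    have h2 : σ (pZX F E c N z) ∈ Nz := hzS.2
    rwa [hz.1] at h2
  have h0 := measure_inter_eq_zero_of_measure_preimage_pZX_eq_zero μ νG hβ hμZ 0 T hSm hpre
  filter_upwards [compl_mem_ae_iff.2 h0] with x hx hxT
  by_contra hne
  exact hx ⟨⟨hxT, hNsub hne⟩, hxT⟩

include hβ hμZ in
/-- **(O2b) THE TRANSPORT OPERATOR.**  On `hSieg`, `T ≥ 1`, with a Siegel section `σ` (§2: measurable, `σ[g⁻¹] = B(F)·g` for `H(g) > T`) and the measure letters of record `hβ`, `hμZ`: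
there are `C ≠ 0, ∞` (the unfolding constant) and a continuous linear `M : 𝓗_0(Z_T) = L²(Z_T, μZ) →L[ℂ] L²(𝔛, μ)` with `M f =ᵐ[μ] 𝟙_{T<w₁}·(f ∘ σ)`, `‖M f‖ = C.toReal^{1/2}·‖f‖`, and
`(M f)(p z) = f z` for a.e. `z ∈ Z_T`.  Square-integrability and the norm: `∫_𝔛 𝟙_{T<w₁}|f∘σ|² dμ = C·∫_{Z_T} |f∘σ∘p|² dμZ = C·∫_{Z_T}|f|² dμZ` (unfolding above the cut-off; `σ∘p = id`
on `Z_T`). [cite: BernsteinLapid2019, §4 Claim 4 (p. 10)] [cite: MoeglinWaldspurger1995, I.2.1] -/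
theorem exists_siegelTransport
    (hSieg : ∀ γ : (quasiSplit F E c N).arithmeticSubgroup, γ ∉ arithmeticBorel F E c N → ∀ g : (quasiSplit F E c N).Adelic,
      1 < borelHeight g → borelHeight ((γ : (quasiSplit F E c N).Adelic) * g) < 1)
    {T : ℝ≥0} (hT : 1 ≤ T) {σ : (quasiSplit F E c N).automorphicQuotient → borelQuotient F E c N} (hσm : Measurable σ)
    (hσ : ∀ g : (quasiSplit F E c N).Adelic, T < borelHeight g → σ ((quasiSplit F E c N).toAutomorphicQuotient g⁻¹) = toBorelQuotient F E c N g) :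
    ∃ (C : ℝ≥0∞) (M : HN F E c N 0 T μZ →L[ℂ] Lp ℂ 2 μ), C ≠ 0 ∧ C ≠ ⊤ ∧
      (∀ f : HN F E c N 0 T μZ, ((M f : Lp ℂ 2 μ) : (quasiSplit F E c N).automorphicQuotient → ℂ) =ᵐ[μ]
        {x | T < supHeight F E c N x}.indicator fun x => ((f : HN F E c N 0 T μZ) : borelQuotient F E c N → ℂ) (σ x)) ∧
      (∀ f : HN F E c N 0 T μZ, ‖M f‖ = C.toReal ^ (1 / 2 : ℝ) * ‖f‖) ∧
      ∀ f : HN F E c N 0 T μZ, ∀ᵐ z ∂(weightedTruncMeasure F E c N 0 T μZ),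
        ((M f : Lp ℂ 2 μ) : (quasiSplit F E c N).automorphicQuotient → ℂ) (pZX F E c N z) = ((f : HN F E c N 0 T μZ) : borelQuotient F E c N → ℂ) z := by
  obtain ⟨C, hC0, hCt, hunf⟩ := exists_mul_lintegral_comp_pZX_eq_of_support μ νG hβ hμZ hSieg hT
  set X_T : Set (quasiSplit F E c N).automorphicQuotient := {x | T < supHeight F E c N x} with hXT
  have hXTm : MeasurableSet X_T := measurableSet_lt measurable_const measurable_supHeight
  -- `σ ∘ p = id` and `w₁ ∘ p = HZ` a.e. on `Z_T`
  have hσp : ∀ᵐ z ∂(weightedTruncMeasure F E c N 0 T μZ), σ (pZX F E c N z) = z ∧ T < supHeight F E c N (pZX F E c N z) := by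
    filter_upwards [ae_lt_borelQuotHeight_weightedTruncMeasure 0 T μZ] with z hz
    induction z using Quotient.inductionOn with
    | h g =>
      change T < borelQuotHeight F E c N (toBorelQuotient F E c N g) at hz
      change σ (pZX F E c N (toBorelQuotient F E c N g)) = toBorelQuotient F E c N g ∧ T < supHeight F E c N (pZX F E c N (toBorelQuotient F E c N g))
      rw [borelQuotHeight_toBorelQuotient] at hz
      refine ⟨by rw [pZX_toBorelQuotient, hσ g hz], ?_⟩
      rw [supHeight_pZX_eq_of_one_lt hSieg (show 1 < borelQuotHeight F E c N (toBorelQuotient F E c N g) by rw [borelQuotHeight_toBorelQuotient]; exact hT.trans_lt hz),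
        borelQuotHeight_toBorelQuotient]
      exact hz
  -- the candidate function and its square norm
  have hmf : ∀ f : HN F E c N 0 T μZ, Measurable (X_T.indicator fun x => ((f : HN F E c N 0 T μZ) : borelQuotient F E c N → ℂ) (σ x)) := fun f =>
    ((Lp.stronglyMeasurable f).measurable.comp hσm).indicator hXTm
  have hsq : ∀ f : HN F E c N 0 T μZ, ∫⁻ x, ‖X_T.indicator (fun x => ((f : HN F E c N 0 T μZ) : borelQuotient F E c N → ℂ) (σ x)) x‖ₑ ^ 2 ∂μ =
      C * ∫⁻ z, ‖((f : HN F E c N 0 T μZ) : borelQuotient F E c N → ℂ) z‖ₑ ^ 2 ∂(weightedTruncMeasure F E c N 0 T μZ) := by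
    intro f
    rw [← hunf (fun x => ‖X_T.indicator (fun x => ((f : HN F E c N 0 T μZ) : borelQuotient F E c N → ℂ) (σ x)) x‖ₑ ^ 2) ((hmf f).enorm.pow_const _)
      (fun x hx => by simp only [Set.indicator_of_notMem (show x ∉ X_T from hx), enorm_zero, ne_eq, OfNat.ofNat_ne_zero, not_false_eq_true, zero_pow])]
    congr 1
    refine lintegral_congr_ae ?_
    filter_upwards [hσp] with z hz
    simp only [Set.indicator_of_mem (show pZX F E c N z ∈ X_T from hz.2), hz.1]
  have heq2 : ∀ {α : Type} [MeasurableSpace α] (ν : Measure α) (g : α → ℂ), eLpNorm g 2 ν = (∫⁻ x, ‖g x‖ₑ ^ 2 ∂ν) ^ (1 / 2 : ℝ) := by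
    intro α _ ν g
    rw [eLpNorm_eq_lintegral_rpow_enorm_toReal two_ne_zero ENNReal.ofNat_ne_top, ENNReal.toReal_ofNat]
    congr 2
    funext x
    rw [show (2 : ℝ) = ((2 : ℕ) : ℝ) by norm_num, ENNReal.rpow_natCast]
  have hnorm : ∀ f : HN F E c N 0 T μZ, eLpNorm (X_T.indicator fun x => ((f : HN F E c N 0 T μZ) : borelQuotient F E c N → ℂ) (σ x)) 2 μ =
      C ^ (1 / 2 : ℝ) * eLpNorm ((f : HN F E c N 0 T μZ) : borelQuotient F E c N → ℂ) 2 (weightedTruncMeasure F E c N 0 T μZ) := by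
    intro f
    rw [heq2, heq2, hsq f, ENNReal.mul_rpow_of_nonneg _ _ (by norm_num)]
  have hmem : ∀ f : HN F E c N 0 T μZ, MemLp (X_T.indicator fun x => ((f : HN F E c N 0 T μZ) : borelQuotient F E c N → ℂ) (σ x)) 2 μ := fun f =>
    ⟨(hmf f).aestronglyMeasurable, by rw [hnorm f]; exact ENNReal.mul_lt_top (ENNReal.rpow_lt_top_of_nonneg (by norm_num) hCt) (Lp.eLpNorm_lt_top f)⟩
  -- linearity
  let Mlin : HN F E c N 0 T μZ →ₗ[ℂ] Lp ℂ 2 μ :=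
    { toFun := fun f => (hmem f).toLp _
      map_add' := fun f f' => by
        rw [← MemLp.toLp_add (hmem f) (hmem f')]
        refine MemLp.toLp_congr _ _ ?_
        have h1 : ∀ᵐ x ∂μ, T < supHeight F E c N x →
            ((f + f' : HN F E c N 0 T μZ) : borelQuotient F E c N → ℂ) (σ x) =
              ((f : HN F E c N 0 T μZ) : borelQuotient F E c N → ℂ) (σ x) + ((f' : HN F E c N 0 T μZ) : borelQuotient F E c N → ℂ) (σ x) :=
          ae_congr_comp_section μ νG hβ hμZ hσm hσp (Lp.coeFn_add f f')
        filter_upwards [h1] with x hx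
        by_cases hxT : x ∈ X_T
        · simp only [Set.indicator_of_mem hxT, Pi.add_apply, hx hxT]
        · simp only [Set.indicator_of_notMem hxT, Pi.add_apply, add_zero]
      map_smul' := fun r f => by
        rw [RingHom.id_apply, ← MemLp.toLp_const_smul r (hmem f)]
        refine MemLp.toLp_congr _ _ ?_
        have h1 : ∀ᵐ x ∂μ, T < supHeight F E c N x →
            ((r • f : HN F E c N 0 T μZ) : borelQuotient F E c N → ℂ) (σ x) = r • ((f : HN F E c N 0 T μZ) : borelQuotient F E c N → ℂ) (σ x) :=
          ae_congr_comp_section μ νG hβ hμZ hσm hσp (Lp.coeFn_smul r f)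
        filter_upwards [h1] with x hx
        by_cases hxT : x ∈ X_T
        · simp only [Set.indicator_of_mem hxT, Pi.smul_apply, hx hxT]
        · simp only [Set.indicator_of_notMem hxT, Pi.smul_apply, smul_zero] }
  have hMnorm : ∀ f : HN F E c N 0 T μZ, ‖Mlin f‖ = C.toReal ^ (1 / 2 : ℝ) * ‖f‖ := by
    intro f
    change ‖(hmem f).toLp _‖ = _
    rw [Lp.norm_toLp, hnorm f, ENNReal.toReal_mul, ← ENNReal.toReal_rpow, Lp.norm_def]
  refine ⟨C, Mlin.mkContinuous (C.toReal ^ (1 / 2 : ℝ)) fun f => (hMnorm f).le, hC0, hCt, fun f => ?_, fun f => ?_, fun f => ?_⟩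
  · rw [LinearMap.mkContinuous_apply]; exact MemLp.coeFn_toLp (hmem f)
  · rw [LinearMap.mkContinuous_apply]; exact hMnorm f
  · have h1 : ((Mlin f : Lp ℂ 2 μ) : (quasiSplit F E c N).automorphicQuotient → ℂ) =ᵐ[μ] X_T.indicator fun x => ((f : HN F E c N 0 T μZ) : borelQuotient F E c N → ℂ) (σ x) :=
      MemLp.coeFn_toLp (hmem f)
    filter_upwards [ae_comp_pZX_of_ae μ νG hβ hμZ 0 T h1, hσp] with z hz hz'
    rw [LinearMap.mkContinuous_apply, hz, Set.indicator_of_mem (show pZX F E c N z ∈ X_T from hz'.2), hz'.1]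

/-! ## §5 A.e. on `Z_T` pulls back through `σ` to a.e. on `𝔛_T` -/

include hβ hμZ in
/-- **A.E. ON `Z_T` ⟹ A.E. ON `𝔛_T` THROUGH `σ`**: on `hSieg`, `T ≥ 1`, a Siegel section `σ` (§2) and the measure letters of record: if `Q z` holds for `μZ`-a.e. `z ∈ Z_T` then `Q (σ x)` holds for
`μ`-a.e. `x` with `w₁(x) > T` (★ S-α DOWN: the preimage under `p` of `{T < w₁} ∩ σ⁻¹(bad)` lies in `bad` up to the null complement of `Z_T`, since `σ ∘ p = id` there).
[cite: BernsteinLapid2019, §4 Claim 4 (p. 10)] -/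
theorem ae_comp_section_of_ae
    (hSieg : ∀ γ : (quasiSplit F E c N).arithmeticSubgroup, γ ∉ arithmeticBorel F E c N → ∀ g : (quasiSplit F E c N).Adelic,
      1 < borelHeight g → borelHeight ((γ : (quasiSplit F E c N).Adelic) * g) < 1)
    {T : ℝ≥0} (hT : 1 ≤ T) {σ : (quasiSplit F E c N).automorphicQuotient → borelQuotient F E c N} (hσm : Measurable σ)
    (hσ : ∀ g : (quasiSplit F E c N).Adelic, T < borelHeight g → σ ((quasiSplit F E c N).toAutomorphicQuotient g⁻¹) = toBorelQuotient F E c N g)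
    {Q : borelQuotient F E c N → Prop} (hQ : ∀ᵐ z ∂(weightedTruncMeasure F E c N 0 T μZ), Q z) :
    ∀ᵐ x ∂μ, T < supHeight F E c N x → Q (σ x) := by
  have hσp : ∀ᵐ z ∂(weightedTruncMeasure F E c N 0 T μZ), σ (pZX F E c N z) = z ∧ T < supHeight F E c N (pZX F E c N z) := by
    filter_upwards [ae_lt_borelQuotHeight_weightedTruncMeasure 0 T μZ] with z hz
    induction z using Quotient.inductionOn with
    | h g =>
      change T < borelQuotHeight F E c N (toBorelQuotient F E c N g) at hz
      change σ (pZX F E c N (toBorelQuotient F E c N g)) = toBorelQuotient F E c N g ∧ T < supHeight F E c N (pZX F E c N (toBorelQuotient F E c N g))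
      rw [borelQuotHeight_toBorelQuotient] at hz
      refine ⟨by rw [pZX_toBorelQuotient, hσ g hz], ?_⟩
      rw [supHeight_pZX_eq_of_one_lt hSieg (show 1 < borelQuotHeight F E c N (toBorelQuotient F E c N g) by rw [borelQuotHeight_toBorelQuotient]; exact hT.trans_lt hz),
        borelQuotHeight_toBorelQuotient]
      exact hz
  classical
  have h := ae_congr_comp_section μ νG hβ hμZ hσm hσp
    (f₁ := fun z => if Q z then (1 : ℂ) else 0) (f₂ := fun _ => (1 : ℂ)) (by filter_upwards [hQ] with z hz; simp only [if_pos hz])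
  filter_upwards [h] with x hx hxT
  have h1 : (if Q (σ x) then (1 : ℂ) else 0) = 1 := hx hxT
  by_contra hQx
  rw [if_neg hQx] at h1
  exact zero_ne_one h1

end Transport


end Summit.HodgeConjecture.HodgeConjecture.Cruxes.H413.K2E1BLSiegelTransportOperatorU

end
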